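import Literature.AlgebraicGeometry.Motives.HodgeStructureLefschetzGroupCenterPointsCount
import Mathlib.FieldTheory.IsAlgClosed.Basic
import HarnessLib

/-!
# `S₀(A)` OF THE FIRST KIND IS A FINITE GROUP OF ORDER `2^{[C₀:ℚ]}`: `#Z(S(A)(K)) = 2^{t_K} ≤ 2^{dim_ℚ C₀}` FOR EVERY FIELD
# `K ⊇ ℚ`, WITH EQUALITY IFF `K` SPLITS THE CENTRE `C₀`, IN PARTICULAR FOR `K` ALGEBRAICALLY CLOSED — the geometric points of
# `S₀ = {γ ∈ C₀ ⊗ R | γ² = 1}` (Milne 1999 §1 p. 645 `S₀(A)(R)`, Prop. 1.7, Remark 1.6; Moonen–Zarhin 1998 §1 Lemma (1))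

[topic AlgebraicGeometry/Motives]

Layer `Literature/AlgebraicGeometry/Motives`, lane `lit-hodgefound` (Track 2 foundations library; prover seat
`lit-hodgefound-p02`, generation 55, self-proposed row g55-#9). THEOREMS ONLY: no definition, no named fact (net debt `0`),
no instance, no notation.  Milne: «`C₀(A)` … is a product of fields … `S₀(A)(R) = {γ ∈ C₀(A) ⊗_ℚ R | γ†γ = 1}`» (p. 645), and
for `†` OF THE FIRST KIND (`†` trivial on `C₀`, types I–III) this is `S₀(R) = {γ ∈ C₀ ⊗ R | γ² = 1} = μ₂(C₀ ⊗ R)`, i.e. `S₀` is the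
finite group scheme `Res_{C₀/ℚ} μ₂`, of order `2^{[C₀:ℚ]}`.  On `K`-points (g55-#8 `Polarization.natCard_center_lefschetzGroupBaseChange_eq_two_pow`):
`#Z(S(H)(K)) = 2^{t_K}` with `t_K` the number of simple factors of the commutative semisimple `K`-algebra `Z_K = Z(C(H)(K)) = C₀ ⊗ K`
(g54-#2), whose dimension is `dim_K Z_K = dim_ℚ C₀` (g54-#6 `finrank_center_centralizer_endAlg_baseChange_eq`).  Here:
(i) `t_K ≤ dim_ℚ C₀`, with equality iff every residue field of `Z_K` is `K` («`K` splits `C₀`»: `C₀ ⊗ K ≅ K × ⋯ × K`) — a reduced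
finite-dimensional commutative `K`-algebra is `Π_𝔪 Z_K/𝔪` (Mathlib's `IsArtinianRing.equivPi`), so `dim_K Z_K = Σ_𝔪 [Z_K/𝔪 : K]`
with every term `≥ 1`;
(ii) FIRST KIND: `#Z(S(H)(K)) ≤ 2^{dim_ℚ C₀}` for every field `K ⊇ ℚ`, `= 2^{dim_ℚ C₀}` iff `K` splits `C₀`;
(iii) `K` ALGEBRAICALLY CLOSED (e.g. `K = ℂ`, `ℚ̄`, `ℚ̄_ℓ`): `t_K = dim_ℚ C₀` and `#Z(S(H)(K)) = 2^{dim_ℚ C₀}` — the geometric points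
of `S₀` number `2^{[C₀:ℚ]}` (every residue field of `Z_K`, a finite extension of `K`, is `K`).

## The sources, verbatim

* J. S. Milne, *Lefschetz classes on abelian varieties*, Duke Math. J. 96 (1999) 639–675 [Milne1999LefschetzClasses] (held
  `paper:doi-10-1215-s0012-7094-99-09620-5`, folio 7 = p. 645 L1–L14): "let `C₀(A)` be the centre of the `ℚ`-algebra `End⁰(A)` —
  it is a product of fields, each of which is either a CM-field or `ℚ`. Every Rosati involution `†` preserves each factor of
  `C₀(A)` and acts on it as complex conjugation. Define `S₀(A)` to be the algebraic group over `ℚ` such that, for all commutative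
  `ℚ`-algebras `R`, `S₀(A)(R) = {γ ∈ C₀(A) ⊗_ℚ R | γ†γ = 1}`. Proposition 1.7. … an isomorphism `C₀(A) ⊗_ℚ ℚ_ℓ → C_ℓ(A)` of
  `ℚ_ℓ`-algebras with involution, and hence an isomorphism of algebraic groups `S₀(A)_{/ℚ_ℓ} → S_ℓ(A)`."; Remark 1.6 (p. 644):
  «`C'(A) ≅ C(A) ⊗_k k'`, `S'(A) ≅ S(A)_{/k'}`»; §2 Summary p. 652 «Semisimple: I, II, III yes; IV no».
* B. J. J. Moonen, Yu. G. Zarhin, *Weil classes on abelian varieties*, J. reine angew. Math. 496 (1998) 83–92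
  [MoonenZarhin1998WeilClasses] (held `paper:arxiv-alg-geom_9612017`, chunk p0002 L121–L127): «Lemma. (1) The center of
  `G_div(X)` is the group `U_{K_B}` given by `U_{K_B}(R) = {a ∈ (K_B ⊗_ℚ R)^* ∣ a a† = 1}`. … in all other cases it is finite.»
* H. Lange, *Abelian Varieties over the Complex Numbers* (2023) [Lange2023AbelianVarietiesComplex], §2.6.2 Lemma 2.6.4.

Nearest tree results, BY NAME: g55-#8 `Polarization.natCard_center_lefschetzGroupBaseChange_eq_two_pow`,
`isReduced_center_centralizer_endAlg_baseChange`; g54-#6 `finrank_center_centralizer_endAlg_baseChange_eq`; g53-#5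
`finite_centralizer_endAlg_baseChange`; Mathlib `IsArtinianRing.equivPi`, `IsAlgClosed.algebraMap_bijective_of_isIntegral`.

## Dictionary and what is proved (namespace `Literature.AlgebraicGeometry.Motives.HodgeStructure`)

`S(H)(K) = ψ.lefschetzGroupBaseChange K`, `C(H)(K) = Subalgebra.centralizer K {a_K | a ∈ E_φ}`, `Z_K = Subalgebra.center K C(H)(K)`,
`C₀ = Subalgebra.center ℚ E_φ`, `t_K = Nat.card (MaximalSpectrum Z_K)`; "first kind" = `∀ z ∈ C₀, z† = z`; "`K` splits `C₀`" =
`∀ 𝔪 : MaximalSpectrum Z_K, finrank_K (Z_K ⧸ 𝔪) = 1`.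

* §1 **`natCard_maximalSpectrum_center_centralizer_le_finrank_center`** (`t_K ≤ dim_ℚ C₀`),
  **`natCard_maximalSpectrum_center_centralizer_eq_finrank_center_iff`** (`t_K = dim_ℚ C₀` iff `K` splits `C₀`),
  **`natCard_maximalSpectrum_center_centralizer_eq_finrank_center_of_isAlgClosed`**,
  **`nonempty_center_centralizer_endAlg_baseChange_algEquiv_pi`** (`K` splits `C₀` ⟹ `C₀ ⊗ K ≅ K^{t_K}` as `K`-algebras),
  **`nonempty_center_centralizer_endAlg_baseChange_algEquiv_pi_of_isAlgClosed`**.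
* §2 **`Polarization.natCard_center_lefschetzGroupBaseChange_le_two_pow_finrank_center`** (first kind: `#Z(S(H)(K)) ≤ 2^{dim_ℚ C₀}`),
  **`Polarization.natCard_center_lefschetzGroupBaseChange_eq_two_pow_finrank_center_iff`** (equality iff `K` splits `C₀`),
  **`Polarization.natCard_center_lefschetzGroupBaseChange_eq_two_pow_finrank_center_of_isAlgClosed`** (`#S₀(K̄) = 2^{[C₀:ℚ]}`).
* §3 **`Polarization.natCard_center_lefschetzGroupBaseChange_complex_eq_two_pow_finrank_center`** (`#Z(S(H)(ℂ)) = 2^{dim_ℚ C₀}`),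
  **`natCard_maximalSpectrum_center_centralizer_complex_eq_finrank_center`** (`t_ℂ = dim_ℚ C₀`).
-/

noncomputable section

open scoped TensorProduct

namespace Literature.AlgebraicGeometry.Motives

namespace HodgeStructure

universe u uK

variable (K : Type uK) [Field K] [Algebra ℚ K] {V : Type u} [AddCommGroup V] [Module ℚ V] [Module.Finite ℚ V] {n : ℤ}
  {H : HodgeStructure V n}

/-! ## §0 Algebra: a reduced finite-dimensional commutative algebra has at most `dim` maximal ideals -/

omit [Algebra ℚ K] [Module.Finite ℚ V] in
/-- **`#MaxSpec(Z) ≤ dim_K Z` FOR A REDUCED FINITE-DIMENSIONAL COMMUTATIVE `K`-ALGEBRA, WITH EQUALITY IFF EVERY RESIDUE FIELD IS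
`K`**: `Z ≅ Π_𝔪 Z/𝔪` (`IsArtinianRing.equivPi`) is `K`-linear, so `dim_K Z = Σ_𝔪 dim_K (Z/𝔪)` with every term `≥ 1`. [folklore] -/
private theorem natCard_maximalSpectrum_le_finrank₅₅₉ (Z : Type*) [CommRing Z] [Algebra K Z] [Module.Finite K Z]
    [IsReduced Z] :
    Nat.card (MaximalSpectrum Z) ≤ Module.finrank K Z ∧
      (Nat.card (MaximalSpectrum Z) = Module.finrank K Z ↔
        ∀ I : MaximalSpectrum Z, Module.finrank K (Z ⧸ I.asIdeal) = 1) := by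
  classical
  haveI : IsArtinianRing Z := IsArtinianRing.of_finite K Z
  haveI := Fintype.ofFinite (MaximalSpectrum Z)
  haveI : ∀ I : MaximalSpectrum Z, Module.Finite K (Z ⧸ I.asIdeal) := fun I =>
    Module.Finite.of_surjective (Ideal.Quotient.mkₐ K I.asIdeal).toLinearMap (Ideal.Quotient.mkₐ_surjective K _)
  haveI : ∀ I : MaximalSpectrum Z, Module.Free K (Z ⧸ I.asIdeal) := fun I => Module.Free.of_divisionRing K _
  -- the `K`-linear isomorphism `Z ≅ Π_𝔪 Z/𝔪`
  let π : Z →ₐ[K] (Π I : MaximalSpectrum Z, Z ⧸ I.asIdeal) :=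
    AlgHom.pi fun I : MaximalSpectrum Z => Ideal.Quotient.mkₐ K I.asIdeal
  have hπ : Function.Bijective π := by
    have h : (π : Z → Π I : MaximalSpectrum Z, Z ⧸ I.asIdeal) = IsArtinianRing.equivPi Z := by
      funext z I
      rfl
    rw [h]
    exact (IsArtinianRing.equivPi Z).bijective
  have hdim : Module.finrank K Z = ∑ I : MaximalSpectrum Z, Module.finrank K (Z ⧸ I.asIdeal) := by
    rw [(LinearEquiv.ofBijective π.toLinearMap hπ).finrank_eq, Module.finrank_pi_fintype]
  have hpos : ∀ I : MaximalSpectrum Z, 1 ≤ Module.finrank K (Z ⧸ I.asIdeal) := fun I => by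
    haveI := ((Ideal.Quotient.maximal_ideal_iff_isField_quotient I.asIdeal).1 I.isMaximal).nontrivial
    exact Module.finrank_pos
  have hcard : Nat.card (MaximalSpectrum Z) = ∑ _I : MaximalSpectrum Z, 1 := by
    rw [Nat.card_eq_fintype_card, ← Finset.card_univ, Finset.card_eq_sum_ones]
  rw [hcard, hdim]
  refine ⟨Finset.sum_le_sum fun I _ => hpos I, ?_⟩
  rw [Finset.sum_eq_sum_iff_of_le fun I _ => hpos I]
  exact ⟨fun h I => (h I (Finset.mem_univ I)).symm, fun h I _ => (h I).symm⟩

omit [Algebra ℚ K] [Module.Finite ℚ V] in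
/-- Over an ALGEBRAICALLY CLOSED field every residue field of a finite-dimensional commutative algebra is the ground field.
[folklore] -/
private theorem finrank_quotient_eq_one_of_isAlgClosed₅₅₉ [IsAlgClosed K] (Z : Type*) [CommRing Z] [Algebra K Z]
    [Module.Finite K Z] (I : MaximalSpectrum Z) : Module.finrank K (Z ⧸ I.asIdeal) = 1 := by
  haveI : Module.Finite K (Z ⧸ I.asIdeal) :=
    Module.Finite.of_surjective (Ideal.Quotient.mkₐ K I.asIdeal).toLinearMap (Ideal.Quotient.mkₐ_surjective K _)
  have hbij := IsAlgClosed.algebraMap_bijective_of_isIntegral (k := K) (K := Z ⧸ I.asIdeal)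
  rw [← (LinearEquiv.ofBijective (Algebra.linearMap K (Z ⧸ I.asIdeal)) hbij).finrank_eq, Module.finrank_self]

omit [Algebra ℚ K] [Module.Finite ℚ V] in
/-- A `K`-algebra of dimension `1` is `K`: `algebraMap K B` is bijective. [folklore] -/
private theorem bijective_algebraMap_of_finrank_eq_one₅₅₉ (B : Type*) [CommRing B] [Nontrivial B] [Algebra K B]
    (h : Module.finrank K B = 1) : Function.Bijective (algebraMap K B) := by
  haveI : Module.Free K B := Module.Free.of_divisionRing K B
  refine ⟨(algebraMap K B).injective, fun b => ?_⟩
  have hb : b ∈ (⊥ : Subalgebra K B) := by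
    rw [Subalgebra.bot_eq_top_iff_finrank_eq_one.2 h]
    exact Algebra.mem_top
  exact Algebra.mem_bot.1 hb

omit [Algebra ℚ K] [Module.Finite ℚ V] in
/-- **A SPLIT REDUCED FINITE-DIMENSIONAL COMMUTATIVE `K`-ALGEBRA IS `K^{MaxSpec}`**: if every residue field of `Z` is `K`, then
`Z ≅ Π_𝔪 Z/𝔪 ≅ Π_𝔪 K` as `K`-algebras (`IsArtinianRing.equivPi`). [folklore] -/
private theorem nonempty_algEquiv_pi_of_split₅₅₉ (Z : Type*) [CommRing Z] [Algebra K Z] [Module.Finite K Z] [IsReduced Z]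
    (hsplit : ∀ I : MaximalSpectrum Z, Module.finrank K (Z ⧸ I.asIdeal) = 1) :
    Nonempty (Z ≃ₐ[K] (MaximalSpectrum Z → K)) := by
  haveI : IsArtinianRing Z := IsArtinianRing.of_finite K Z
  have e : ∀ I : MaximalSpectrum Z, (Z ⧸ I.asIdeal) ≃ₐ[K] K := fun I =>
    haveI := ((Ideal.Quotient.maximal_ideal_iff_isField_quotient I.asIdeal).1 I.isMaximal).nontrivial
    (AlgEquiv.ofBijective (Algebra.ofId K (Z ⧸ I.asIdeal))
      (bijective_algebraMap_of_finrank_eq_one₅₅₉ K _ (hsplit I))).symm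
  exact ⟨((IsArtinianRing.equivPi Z).restrictScalars K).trans (AlgEquiv.piCongrRight e)⟩

/-! ## §1 `t_K ≤ dim_ℚ C₀`, with equality iff `K` splits `C₀` — in particular over an algebraically closed `K` -/

set_option maxSynthPendingDepth 4 in
/-- The standing instances on `Z_K`: finite-dimensional over `K`. [folklore] -/
private theorem finite_center_centralizer₅₅₉ :
    Module.Finite K (Subalgebra.center K (Subalgebra.centralizer K
      ((fun a : Module.End ℚ V => a.baseChange K) '' (H.endAlg : Set (Module.End ℚ V))))) := by
  haveI := finite_centralizer_endAlg_baseChange K H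
  haveI : IsNoetherian K (Subalgebra.centralizer K
      ((fun a : Module.End ℚ V => a.baseChange K) '' (H.endAlg : Set (Module.End ℚ V)))) :=
    isNoetherian_of_isNoetherianRing_of_finite K _
  exact Module.Finite.of_injective (Subalgebra.val _).toLinearMap Subtype.val_injective

set_option maxSynthPendingDepth 4 in
/-- **`t_K ≤ dim_ℚ C₀`**: the number of simple factors of `C₀ ⊗ K = Z(C(H)(K))` (its maximal ideals) is at most
`dim_K Z(C(H)(K)) = dim_ℚ C₀` (g54-#6). [cite: Milne1999LefschetzClasses, §1 Remark 1.6 (p. 644) and p. 645 L1–L6] -/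
theorem natCard_maximalSpectrum_center_centralizer_le_finrank_center (hH : H.IsPolarizable) :
    Nat.card (MaximalSpectrum (Subalgebra.center K (Subalgebra.centralizer K
        ((fun a : Module.End ℚ V => a.baseChange K) '' (H.endAlg : Set (Module.End ℚ V)))))) ≤
      Module.finrank ℚ (Subalgebra.center ℚ H.endAlg) := by
  haveI := finite_center_centralizer₅₅₉ K (H := H)
  haveI := isReduced_center_centralizer_endAlg_baseChange K hH
  rw [← finrank_center_centralizer_endAlg_baseChange_eq K H hH]
  exact (natCard_maximalSpectrum_le_finrank₅₅₉ K (Subalgebra.center K (Subalgebra.centralizer K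
    ((fun a : Module.End ℚ V => a.baseChange K) '' (H.endAlg : Set (Module.End ℚ V)))))).1

set_option maxSynthPendingDepth 4 in
/-- **`t_K = dim_ℚ C₀` IFF `K` SPLITS `C₀`** (every residue field of `Z(C(H)(K)) = C₀ ⊗ K` is `K`, i.e. `C₀ ⊗ K ≅ K^{dim_ℚ C₀}`).
[cite: Milne1999LefschetzClasses, §1 Remark 1.6 (p. 644) and p. 645 L1–L6] -/
theorem natCard_maximalSpectrum_center_centralizer_eq_finrank_center_iff (hH : H.IsPolarizable) :
    Nat.card (MaximalSpectrum (Subalgebra.center K (Subalgebra.centralizer K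
        ((fun a : Module.End ℚ V => a.baseChange K) '' (H.endAlg : Set (Module.End ℚ V)))))) =
      Module.finrank ℚ (Subalgebra.center ℚ H.endAlg) ↔
      ∀ I : MaximalSpectrum (Subalgebra.center K (Subalgebra.centralizer K
        ((fun a : Module.End ℚ V => a.baseChange K) '' (H.endAlg : Set (Module.End ℚ V))))),
        Module.finrank K (Subalgebra.center K (Subalgebra.centralizer K
          ((fun a : Module.End ℚ V => a.baseChange K) '' (H.endAlg : Set (Module.End ℚ V)))) ⧸ I.asIdeal) = 1 := by
  haveI := finite_center_centralizer₅₅₉ K (H := H)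
  haveI := isReduced_center_centralizer_endAlg_baseChange K hH
  rw [← finrank_center_centralizer_endAlg_baseChange_eq K H hH]
  exact (natCard_maximalSpectrum_le_finrank₅₅₉ K (Subalgebra.center K (Subalgebra.centralizer K
    ((fun a : Module.End ℚ V => a.baseChange K) '' (H.endAlg : Set (Module.End ℚ V)))))).2

set_option maxSynthPendingDepth 4 in
/-- **`K` ALGEBRAICALLY CLOSED ⟹ `t_K = dim_ℚ C₀`**: over `K̄` the centre `C₀ ⊗ K̄` splits completely into `dim_ℚ C₀` copies of
`K̄`. [cite: Milne1999LefschetzClasses, §1 Remark 1.6 (p. 644) and p. 645 L1–L6] -/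
theorem natCard_maximalSpectrum_center_centralizer_eq_finrank_center_of_isAlgClosed [IsAlgClosed K]
    (hH : H.IsPolarizable) :
    Nat.card (MaximalSpectrum (Subalgebra.center K (Subalgebra.centralizer K
        ((fun a : Module.End ℚ V => a.baseChange K) '' (H.endAlg : Set (Module.End ℚ V)))))) =
      Module.finrank ℚ (Subalgebra.center ℚ H.endAlg) := by
  haveI := finite_center_centralizer₅₅₉ K (H := H)
  exact (natCard_maximalSpectrum_center_centralizer_eq_finrank_center_iff K hH).2 fun I =>
    finrank_quotient_eq_one_of_isAlgClosed₅₅₉ K _ I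

set_option maxSynthPendingDepth 4 in
/-- **`K` SPLITS `C₀` ⟹ `Z(C(H)(K)) = C₀ ⊗ K ≅ K^{t_K}` AS `K`-ALGEBRAS** (and then `t_K = dim_ℚ C₀`, previous statements): Milne's
«`C₀(A)` is a product of fields» after a splitting extension of scalars («`C'(A) ≅ C(A) ⊗_k k'`»).
[cite: Milne1999LefschetzClasses, §1 Remark 1.6 (p. 644) and p. 645 L1–L6] -/
theorem nonempty_center_centralizer_endAlg_baseChange_algEquiv_pi (hH : H.IsPolarizable)
    (hsplit : ∀ I : MaximalSpectrum (Subalgebra.center K (Subalgebra.centralizer K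
        ((fun a : Module.End ℚ V => a.baseChange K) '' (H.endAlg : Set (Module.End ℚ V))))),
        Module.finrank K (Subalgebra.center K (Subalgebra.centralizer K
          ((fun a : Module.End ℚ V => a.baseChange K) '' (H.endAlg : Set (Module.End ℚ V)))) ⧸ I.asIdeal) = 1) :
    Nonempty (Subalgebra.center K (Subalgebra.centralizer K
        ((fun a : Module.End ℚ V => a.baseChange K) '' (H.endAlg : Set (Module.End ℚ V)))) ≃ₐ[K]
      (MaximalSpectrum (Subalgebra.center K (Subalgebra.centralizer K
        ((fun a : Module.End ℚ V => a.baseChange K) '' (H.endAlg : Set (Module.End ℚ V))))) → K)) := by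
  haveI := finite_center_centralizer₅₅₉ K (H := H)
  haveI := isReduced_center_centralizer_endAlg_baseChange K hH
  exact nonempty_algEquiv_pi_of_split₅₅₉ K _ hsplit

set_option maxSynthPendingDepth 4 in
/-- **`K` ALGEBRAICALLY CLOSED ⟹ `C₀ ⊗ K ≅ K^{dim_ℚ C₀}`**: `Z(C(H)(K̄)) ≅ K̄^{t}`, `t = t_{K̄} = dim_ℚ C₀`, as `K̄`-algebras.
[cite: Milne1999LefschetzClasses, §1 Remark 1.6 (p. 644) and p. 645 L1–L6] -/
theorem nonempty_center_centralizer_endAlg_baseChange_algEquiv_pi_of_isAlgClosed [IsAlgClosed K] (hH : H.IsPolarizable) :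
    Nonempty (Subalgebra.center K (Subalgebra.centralizer K
        ((fun a : Module.End ℚ V => a.baseChange K) '' (H.endAlg : Set (Module.End ℚ V)))) ≃ₐ[K]
      (MaximalSpectrum (Subalgebra.center K (Subalgebra.centralizer K
        ((fun a : Module.End ℚ V => a.baseChange K) '' (H.endAlg : Set (Module.End ℚ V))))) → K)) := by
  haveI := finite_center_centralizer₅₅₉ K (H := H)
  exact nonempty_center_centralizer_endAlg_baseChange_algEquiv_pi K hH fun I =>
    finrank_quotient_eq_one_of_isAlgClosed₅₅₉ K _ I

/-! ## §2 First kind: `#Z(S(H)(K)) ≤ 2^{dim_ℚ C₀}`, `= 2^{dim_ℚ C₀}` iff `K` splits `C₀`, e.g. `K` algebraically closed -/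

set_option maxSynthPendingDepth 4 in
/-- **FIRST KIND: `#Z(S(A)(K)) ≤ 2^{dim_ℚ C₀}` FOR EVERY FIELD `K ⊇ ℚ`** — `#Z(S(H)(K)) = 2^{t_K}` (g55-#8) and `t_K ≤ dim_ℚ C₀`
(§1): the `K`-points of the finite group scheme `S₀ = {γ ∈ C₀ ⊗ R | γ² = 1}` never exceed its order `2^{[C₀:ℚ]}`.
[cite: Milne1999LefschetzClasses, §1 p. 645 L1–L14 (S₀, Prop. 1.7) and Remark 1.6 (p. 644)] [cite: MoonenZarhin1998WeilClasses, §1 Lemma (1)] -/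
theorem Polarization.natCard_center_lefschetzGroupBaseChange_le_two_pow_finrank_center (ψ : Polarization H)
    (hfix : ∀ z : H.endAlg, z ∈ Subalgebra.center ℚ H.endAlg → ψ.adjoint (z : Module.End ℚ V) = z) :
    Nat.card (Subgroup.center (ψ.lefschetzGroupBaseChange K)) ≤ 2 ^ Module.finrank ℚ (Subalgebra.center ℚ H.endAlg) := by
  rw [ψ.natCard_center_lefschetzGroupBaseChange_eq_two_pow K hfix]
  exact Nat.pow_le_pow_right two_pos (natCard_maximalSpectrum_center_centralizer_le_finrank_center K ⟨ψ⟩)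

set_option maxSynthPendingDepth 4 in
/-- **FIRST KIND: `#Z(S(A)(K)) = 2^{dim_ℚ C₀}` IFF `K` SPLITS `C₀`.** [cite: Milne1999LefschetzClasses, §1 p. 645 L1–L14 (S₀, Prop. 1.7) and Remark 1.6 (p. 644)]
[cite: MoonenZarhin1998WeilClasses, §1 Lemma (1)] -/
theorem Polarization.natCard_center_lefschetzGroupBaseChange_eq_two_pow_finrank_center_iff (ψ : Polarization H)
    (hfix : ∀ z : H.endAlg, z ∈ Subalgebra.center ℚ H.endAlg → ψ.adjoint (z : Module.End ℚ V) = z) :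
    Nat.card (Subgroup.center (ψ.lefschetzGroupBaseChange K)) = 2 ^ Module.finrank ℚ (Subalgebra.center ℚ H.endAlg) ↔
      ∀ I : MaximalSpectrum (Subalgebra.center K (Subalgebra.centralizer K
        ((fun a : Module.End ℚ V => a.baseChange K) '' (H.endAlg : Set (Module.End ℚ V))))),
        Module.finrank K (Subalgebra.center K (Subalgebra.centralizer K
          ((fun a : Module.End ℚ V => a.baseChange K) '' (H.endAlg : Set (Module.End ℚ V)))) ⧸ I.asIdeal) = 1 := by
  rw [ψ.natCard_center_lefschetzGroupBaseChange_eq_two_pow K hfix,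
    ← natCard_maximalSpectrum_center_centralizer_eq_finrank_center_iff K ⟨ψ⟩]
  exact (Nat.pow_right_injective le_rfl).eq_iff

set_option maxSynthPendingDepth 4 in
/-- **FIRST KIND, `K` ALGEBRAICALLY CLOSED: `#Z(S(A)(K)) = 2^{dim_ℚ C₀}`** — the geometric points of `S₀ = Res_{C₀/ℚ} μ₂` number
`2^{[C₀:ℚ]}` (types I–III; «Semisimple: I, II, III yes»). [cite: Milne1999LefschetzClasses, §1 p. 645 L1–L14 (S₀, Prop. 1.7), Remark 1.6 (p. 644) and §2 Summary p. 652]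
[cite: MoonenZarhin1998WeilClasses, §1 Lemma (1)] [cite: Lange2023AbelianVarietiesComplex, §2.6.2 Lemma 2.6.4] -/
theorem Polarization.natCard_center_lefschetzGroupBaseChange_eq_two_pow_finrank_center_of_isAlgClosed [IsAlgClosed K]
    (ψ : Polarization H) (hfix : ∀ z : H.endAlg, z ∈ Subalgebra.center ℚ H.endAlg → ψ.adjoint (z : Module.End ℚ V) = z) :
    Nat.card (Subgroup.center (ψ.lefschetzGroupBaseChange K)) = 2 ^ Module.finrank ℚ (Subalgebra.center ℚ H.endAlg) := by
  rw [ψ.natCard_center_lefschetzGroupBaseChange_eq_two_pow K hfix,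
    natCard_maximalSpectrum_center_centralizer_eq_finrank_center_of_isAlgClosed K ⟨ψ⟩]

/-! ## §3 Complex points: `#Z(S_B(A)(ℂ)) = 2^{dim_ℚ C₀}` -/

set_option maxSynthPendingDepth 4 in
/-- **FIRST KIND: THE CENTRE OF THE COMPLEX POINTS `S(A)(ℂ)` HAS ORDER `2^{dim_ℚ C₀}`** (`K = ℂ` algebraically closed; Milne's
comparison `S_B(A)_{/ℂ} ≅ S_dR(A)`, p. 644). [cite: Milne1999LefschetzClasses, §1 p. 644 (comparison isomorphisms), p. 645 L1–L14 and Remark 1.6]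
[cite: MoonenZarhin1998WeilClasses, §1 Lemma (1)] -/
theorem Polarization.natCard_center_lefschetzGroupBaseChange_complex_eq_two_pow_finrank_center (ψ : Polarization H)
    (hfix : ∀ z : H.endAlg, z ∈ Subalgebra.center ℚ H.endAlg → ψ.adjoint (z : Module.End ℚ V) = z) :
    Nat.card (Subgroup.center (ψ.lefschetzGroupBaseChange ℂ)) = 2 ^ Module.finrank ℚ (Subalgebra.center ℚ H.endAlg) :=
  ψ.natCard_center_lefschetzGroupBaseChange_eq_two_pow_finrank_center_of_isAlgClosed ℂ hfix

/-- **FIRST KIND: `Z(C(H)(ℂ)) = C₀ ⊗ ℂ ≅ ℂ^{dim_ℚ C₀}`** — the centre splits completely over `ℂ`, into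
`t_ℂ = dim_ℚ C₀` factors. [cite: Milne1999LefschetzClasses, §1 Remark 1.6 (p. 644) and p. 645 L1–L6] -/
theorem natCard_maximalSpectrum_center_centralizer_complex_eq_finrank_center (hH : H.IsPolarizable) :
    Nat.card (MaximalSpectrum (Subalgebra.center ℂ (Subalgebra.centralizer ℂ
        ((fun a : Module.End ℚ V => a.baseChange ℂ) '' (H.endAlg : Set (Module.End ℚ V)))))) =
      Module.finrank ℚ (Subalgebra.center ℚ H.endAlg) :=
  natCard_maximalSpectrum_center_centralizer_eq_finrank_center_of_isAlgClosed ℂ hH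

end HodgeStructure

end Literature.AlgebraicGeometry.Motives
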